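import Literature.NumberTheory.GaloisRepresentations.LubinTateUnramifiedAnomalyCokernel
import Literature.NumberTheory.GaloisRepresentations.LubinTateUnitBallIntegralClosure
import Mathlib.FieldTheory.Galois.NormalBasis
import HarnessLib

/-!
# The integral normal basis of an unramified extension: `𝒪_E` is free over `𝒪_F` on `θ, φθ, …, φ^{d−1}θ`

Noether's integral normal basis theorem in the unramified case (Serre, *Local Fields* (1979), Ch. I §4 Prop. 10 with Ch. III §4;
Fröhlich, *Galois module structure*, Ch. I §3: "tame ⇒ `𝒪_L` free over `𝒪_K[G]`", here `G = ⟨φ⟩` cyclic and the extension unramified):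
for a finite `E ⊆ F^{nr}` over the non-archimedean local field `F` (degree `d`, separable) and a ring endomorphism `ψ` of `𝒪_E` over `𝒪_F`
reducing to the `q`-Frobenius (`ψ(c) ≡ c^q (mod π)`, e.g. the Frobenius `φ`), **there is `θ ∈ 𝒪_E` such that `θ, ψθ, …, ψ^{d−1}θ` is an
`𝒪_F`-basis of `𝒪_E`**.  Proof: the residue ring `𝓀_E = 𝒪_E/π𝒪_E` is a finite field, an algebra over `𝓀_F` of degree `d`
(`|𝓀_E| = q^d`, `LubinTateUnitBallIntegralClosure`); Mathlib's normal basis theorem (`exists_linearIndependent_algEquiv_apply`) and the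
cyclicity of `Gal(𝓀_E/𝓀_F) = ⟨Frob_q⟩` (`bijective_frobeniusAlgEquivOfAlgebraic_pow`) give `x ∈ 𝓀_E` with `x, x^q, …, x^{q^{d−1}}`
linearly independent over `𝓀_F`; a lift `θ` of `x` has `ψ^iθ ≡ x^{q^i}`, so the `ψ^iθ` span `𝒪_E` modulo `𝔪_F𝒪_E = π𝒪_E`, hence span
`𝒪_E` (Nakayama, `𝒪_E` finite over the local ring `𝒪_F`), hence form a basis (`d` generators of a free module of rank `d`).  Everything
PROVED (0 sorry, no named facts):

* `isMaximal_span_pi` — `π𝒪_E` is a maximal ideal of `𝒪_E` (`E ⊆ F^{nr}`): `𝓀_E` is a finite field;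
* ★★ `exists_basis_eq_pow_apply` — **the integral normal basis `(ψ^i θ)_{i < [E:F]}` of `𝒪_E` over `𝒪_F`**.

Consequences for brick (c) (de Shalit I §3.7–3.8, `BRICK-C-NORM-g7.md` §4): `𝒪_E ≅ 𝒪_F[T]/(T^d − 1)` as a module over `𝒪_F[φ]`, which
gives the exact cokernel `𝒪_E/(1 − uφ)𝒪_E ≅ 𝒪_F/(1 − u^d)` of Theorem I.3.7 and the trace-coherent description of `lim_{k′} 𝒪_{k′}⟦Y⟧`.

## References

* J.-P. Serre, *Local Fields* (1979), Ch. I §4 Prop. 10, Ch. III §4 (unramified extensions and their residue fields). [SerreLocalFields1979]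
* E. de Shalit, *Iwasawa theory of elliptic curves with complex multiplication* (1987), Ch. I §3.7, §3.14 ("since `k′/k` is unramified"). [deShalit1987]
-/

noncomputable section

namespace Literature.NumberTheory.GaloisRepresentations

section UnramifiedNormalBasis

open GaloisRepresentations.IsNonarchimedeanLocalField LubinTate ValuativeRel Field

variable {F : Type} [Field F] [ValuativeRel F] [TopologicalSpace F] [IsNonarchimedeanLocalField F]

attribute [local instance] ltNormUniformSpace ltNormIsUniformAddGroup rk1 nF nE fintypeResidueField

variable {π : 𝒪[F]} (hπ : (valuation F).IsUniformizer (π : F))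
variable (E : IntermediateField F (AlgebraicClosure F)) [FiniteDimensional F E]

/-! ### The residue field of an unramified `E` -/

include hπ in
/-- **`π𝒪_E` is a maximal ideal** for `E ⊆ F^{nr}` finite (the quotient is a finite integral domain, hence a field): `𝓀_E = 𝒪_E/π𝒪_E` is
the residue field of `E`. [cite: SerreLocalFields1979, Ch. I §4 Prop. 10] -/
theorem isMaximal_span_pi (hE : E ≤ maxUnramified F) : (Ideal.span {algebraMap 𝒪[F] (unitBall E) π}).IsMaximal := by
  haveI := isPrime_span_algebraMap_pi hπ E hE
  haveI := finite_quotient_span_pi hπ E hE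
  exact Ideal.Quotient.maximal_of_isField _
    (Finite.isField_of_domain (unitBall E ⧸ Ideal.span {algebraMap 𝒪[F] (unitBall E) π}))

/-- `ψ^i(c) ≡ c^{q^i} (mod π)` when `ψ(c) ≡ c^q (mod π)` and `ψ(π) = π`. [cite: SerreLocalFields1979, Ch. I §8] -/
theorem iterate_sub_pow_pow_mem {ψ : unitBall E →+* unitBall E}
    (hψπ : ψ (algebraMap 𝒪[F] (unitBall E) π) = algebraMap 𝒪[F] (unitBall E) π)
    (hψ : ∀ c : unitBall E, ψ c - c ^ residueFieldCard F ∈ Ideal.span {algebraMap 𝒪[F] (unitBall E) π}) (i : ℕ) (c : unitBall E) :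
    (ψ ^ i) c - c ^ residueFieldCard F ^ i ∈ Ideal.span {algebraMap 𝒪[F] (unitBall E) π} := by
  induction i with
  | zero => rw [pow_zero, pow_zero, pow_one, RingHom.one_def, RingHom.id_apply, sub_self]; exact zero_mem _
  | succ i ih =>
    have h1 : ψ ((ψ ^ i) c) - (ψ c) ^ residueFieldCard F ^ i ∈ Ideal.span {algebraMap 𝒪[F] (unitBall E) π} := by
      rw [← map_pow, ← map_sub]
      obtain ⟨y, hy⟩ := Ideal.mem_span_singleton'.mp ih
      rw [← hy, map_mul, hψπ]
      exact Ideal.mul_mem_left _ _ (Ideal.mem_span_singleton_self _)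
    have h2 : (ψ c) ^ residueFieldCard F ^ i - (c ^ residueFieldCard F) ^ residueFieldCard F ^ i ∈
        Ideal.span {algebraMap 𝒪[F] (unitBall E) π} :=
      Ideal.mem_span_singleton.mpr (dvd_trans (Ideal.mem_span_singleton.mp (hψ c)) (sub_dvd_pow_sub_pow _ _ _))
    have e : (ψ ^ (i + 1)) c - c ^ residueFieldCard F ^ (i + 1) =
        (ψ ((ψ ^ i) c) - (ψ c) ^ residueFieldCard F ^ i) +
          ((ψ c) ^ residueFieldCard F ^ i - (c ^ residueFieldCard F) ^ residueFieldCard F ^ i) := by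
      rw [pow_succ', RingHom.mul_def, RingHom.comp_apply, pow_succ', pow_mul]
      ring
    rw [e]
    exact add_mem h1 h2

/-! ### The integral normal basis -/

include hπ in
set_option maxHeartbeats 800000 in
/-- ★★ **Integral normal basis of an unramified extension**: for `E ⊆ F^{nr}` finite separable over `F` and a ring endomorphism `ψ` of
`𝒪_E` over `𝒪_F` with `ψ(c) ≡ c^q (mod π)` (e.g. the Frobenius), there is `θ ∈ 𝒪_E` such that **`(ψ^i θ)_{i < [E:F]}` is an `𝒪_F`-basis of
`𝒪_E`** (normal basis of the finite field `𝓀_E` over `𝓀_F` in Frobenius form, lifted by Nakayama).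
[cite: SerreLocalFields1979, Ch. I §4 Prop. 10] -/
theorem exists_basis_eq_pow_apply (hE : E ≤ maxUnramified F) [Algebra.IsSeparable F E] {ψ : unitBall E →+* unitBall E}
    (hψa : ∀ a : 𝒪[F], ψ (algebraMap 𝒪[F] (unitBall E) a) = algebraMap 𝒪[F] (unitBall E) a)
    (hψ : ∀ c : unitBall E, ψ c - c ^ residueFieldCard F ∈ Ideal.span {algebraMap 𝒪[F] (unitBall E) π}) :
    ∃ (θ : unitBall E) (b : Module.Basis (Fin (Module.finrank F E)) 𝒪[F] (unitBall E)),
      ∀ i, b i = (ψ ^ (i : ℕ)) θ := by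
  classical
  obtain ⟨P, hP⟩ : ∃ P : Ideal (unitBall E), P = Ideal.span {algebraMap 𝒪[F] (unitBall E) π} := ⟨_, rfl⟩
  haveI hPmax : P.IsMaximal := hP ▸ isMaximal_span_pi hπ E hE
  letI : Field (unitBall E ⧸ P) := Ideal.Quotient.field P
  haveI hfin : Finite (unitBall E ⧸ P) := hP ▸ finite_quotient_span_pi hπ E hE
  letI : Fintype (unitBall E ⧸ P) := Fintype.ofFinite _
  -- the residue field as a `𝓀_F`-algebra
  have hle : 𝓂[F] ≤ P.comap (algebraMap 𝒪[F] (unitBall E)) := fun a ha => by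
    rw [Ideal.mem_comap, hP]
    exact algebraMap_mem_span_of_mem_maximalIdeal hπ E ha
  letI instAlg : Algebra 𝓀[F] (unitBall E ⧸ P) := (Ideal.quotientMap P (algebraMap 𝒪[F] (unitBall E)) hle).toAlgebra
  letI instMod : Module 𝓀[F] (unitBall E ⧸ P) := Algebra.toModule
  letI instSMul : SMul 𝓀[F] (unitBall E ⧸ P) := Algebra.toSMul
  have hsmul : ∀ (a : 𝒪[F]) (y : unitBall E ⧸ P),
      (IsLocalRing.residue 𝒪[F] a) • y = Ideal.Quotient.mk P (algebraMap 𝒪[F] (unitBall E) a) * y := fun a y => by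
    rw [Algebra.smul_def]
    rfl
  -- `[𝓀_E : 𝓀_F] = d`
  obtain ⟨d, hd⟩ : ∃ d : ℕ, d = Module.finrank F E := ⟨_, rfl⟩
  rw [← hd]
  have hq : Fintype.card 𝓀[F] = residueFieldCard F := by rw [residueFieldCard, Nat.card_eq_fintype_card]
  have hcard : Fintype.card (unitBall E ⧸ P) = residueFieldCard F ^ d := by
    rw [← Nat.card_eq_fintype_card, hP, hd]
    exact natCard_quotient_span_pi E hπ
  haveI : FiniteDimensional 𝓀[F] (unitBall E ⧸ P) := Module.Finite.of_finite
  have hfinrank : Module.finrank 𝓀[F] (unitBall E ⧸ P) = d := by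
    have h1 := Module.card_eq_pow_finrank (K := 𝓀[F]) (V := unitBall E ⧸ P)
    rw [hcard, hq] at h1
    exact (Nat.pow_right_injective (one_lt_residueFieldCard F) h1).symm
  -- the normal basis of `𝓀_E / 𝓀_F` in Frobenius form
  obtain ⟨x, hx⟩ := exists_linearIndependent_algEquiv_apply 𝓀[F] (unitBall E ⧸ P)
  have hbij := FiniteField.bijective_frobeniusAlgEquivOfAlgebraic_pow 𝓀[F] (unitBall E ⧸ P)
  have hli₀ : LinearIndependent 𝓀[F] (fun i : Fin d => x ^ residueFieldCard F ^ (i : ℕ)) := by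
    have h1 := (hx.comp _ hbij.1).comp (Fin.cast hfinrank.symm) (Fin.cast_injective _)
    have hfun : (((fun σ : (unitBall E ⧸ P) ≃ₐ[𝓀[F]] (unitBall E ⧸ P) => σ x) ∘
        fun n : Fin (Module.finrank 𝓀[F] (unitBall E ⧸ P)) =>
          FiniteField.frobeniusAlgEquivOfAlgebraic 𝓀[F] (unitBall E ⧸ P) ^ (n : ℕ)) ∘ Fin.cast hfinrank.symm) =
        fun i : Fin d => x ^ residueFieldCard F ^ (i : ℕ) := by
      funext i
      simp only [Function.comp_apply, AlgEquiv.coe_pow, FiniteField.coe_frobeniusAlgEquivOfAlgebraic_iterate, hq, Fin.val_cast]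
    rw [hfun] at h1
    exact h1
  have hne : Nonempty (Fin d) := ⟨⟨0, by rw [hd]; exact Module.finrank_pos⟩⟩
  have hspan₀ : Submodule.span 𝓀[F] (Set.range fun i : Fin d => x ^ residueFieldCard F ^ (i : ℕ)) = ⊤ :=
    hli₀.span_eq_top_of_card_eq_finrank (by rw [Fintype.card_fin, hfinrank])
  -- lift `x` to `θ`; the family `ψ^i θ`
  obtain ⟨θ, hθ⟩ := Ideal.Quotient.mk_surjective x
  obtain ⟨v, hv⟩ : ∃ v : Fin d → unitBall E, v = fun i : Fin d => (ψ ^ (i : ℕ)) θ := ⟨_, rfl⟩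
  have hv_mk : ∀ i : Fin d, Ideal.Quotient.mk P (v i) = x ^ residueFieldCard F ^ (i : ℕ) := by
    intro i
    rw [hv, ← hθ, ← map_pow, Ideal.Quotient.eq, hP]
    exact iterate_sub_pow_pow_mem E (hψa π) hψ i θ
  -- spanning modulo `𝔪_F`
  obtain ⟨s, hs⟩ : ∃ s : 𝓀[F] → 𝒪[F], ∀ k, IsLocalRing.residue 𝒪[F] (s k) = k :=
    ⟨Function.surjInv Ideal.Quotient.mk_surjective, Function.surjInv_eq Ideal.Quotient.mk_surjective⟩
  have hNN : (⊤ : Submodule 𝒪[F] (unitBall E)) ≤ Submodule.span 𝒪[F] (Set.range v) ⊔ 𝓂[F] • ⊤ := by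
    intro c _
    have hc : Ideal.Quotient.mk P c ∈ Submodule.span 𝓀[F] (Set.range fun i : Fin d => x ^ residueFieldCard F ^ (i : ℕ)) := by
      rw [hspan₀]; exact Submodule.mem_top
    obtain ⟨a, ha⟩ := (Submodule.mem_span_range_iff_exists_fun 𝓀[F]).mp hc
    have hmem : c - ∑ i, s (a i) • v i ∈ P := by
      rw [← Ideal.Quotient.eq, map_sum, ← ha]
      refine Finset.sum_congr rfl fun i _ => ?_
      rw [Algebra.smul_def (s (a i)) (v i), map_mul, hv_mk]
      conv_lhs => rw [← hs (a i)]
      rw [hsmul]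
    have e : c = (∑ i, s (a i) • v i) + (c - ∑ i, s (a i) • v i) := by abel
    rw [e]
    refine Submodule.add_mem_sup (Submodule.sum_mem _ fun i _ => Submodule.smul_mem _ _ (Submodule.subset_span ⟨i, rfl⟩)) ?_
    rw [hP] at hmem
    obtain ⟨y, hy⟩ := Ideal.mem_span_singleton'.mp hmem
    rw [← hy, mul_comm, ← Algebra.smul_def]
    refine Submodule.smul_mem_smul ?_ Submodule.mem_top
    rw [maximalIdeal_eq_span_singleton hπ]
    exact Ideal.mem_span_singleton_self π
  -- Nakayama
  haveI := module_finite_unitBall E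
  have htop : (⊤ : Submodule 𝒪[F] (unitBall E)) ≤ Submodule.span 𝒪[F] (Set.range v) :=
    Submodule.le_of_le_smul_of_le_jacobson_bot Module.Finite.fg_top (IsLocalRing.maximalIdeal_le_jacobson ⊥) hNN
  -- `d` generators of a free module of rank `d` form a basis
  haveI := module_free_unitBall E
  have hcardι : Fintype.card (Fin d) = Module.finrank 𝒪[F] (unitBall E) := by rw [Fintype.card_fin, finrank_integer_unitBall, hd]
  have hvli : LinearIndependent 𝒪[F] v := linearIndependent_of_top_le_span_of_card_eq_finrank htop hcardι
  exact ⟨θ, Module.Basis.mk hvli htop, fun i => by rw [Module.Basis.mk_apply, hv]⟩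

end UnramifiedNormalBasis

end Literature.NumberTheory.GaloisRepresentations
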